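import Mathlib
import Literature.MathematicalPhysics.StatisticalMechanics.BarlowStacking
import Summits.Ventures.Crystal3D.Theorems.StickyWulffConstantLayerChainDefs
import HarnessLib

/-!
# Plateau height for line `LayerChain` v4 (crux `StackingLiminf`, stmt-Ventures-19145), part 2:
# half-open BARLOW CELLS — one per lattice point, volume `1/√2`, diameter `≤ 2`, pairwise disjoint

Route `StickyWulffConstant` of the venture `Summits/Ventures/Crystal3D` (cell `crystal3d-full`).
`exists_barlowCells`: an assignment `p ↦ Q p ⊆ ℝ³` (`Fin 3 → ℝ` coordinates) of a measurable set
of Lebesgue volume exactly `1/√2` — the co-volume `(√3/2)·√(2/3)` of the unit-bond Barlow packings —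
lying in the Euclidean ball `B̄(p, 2)`, such that the cells of two distinct points
`barlowPos 1 √(2/3) s k i j ≠ barlowPos 1 √(2/3) s k' i' j'` of ANY Barlow stacking (no Hägg
condition needed) are disjoint.  Construction: `Q p = p + T [0,1)³` with `T` the frame
`(u, v, h e₃)` of the triangular layers (`u = (1,0,0)`, `v = (½, √3/2, 0)`, `h = √(2/3)`), written
as the preimage of the unit box under the inverse frame `A d = (d₀ − d₁/√3, (2/√3) d₁, d₂/h)`
(`det A = 2/(√3 h) = √2`, `Measure.addHaar_preimage_linearMap`); disjointness: `A (P' − P) =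
(Δi + ΔL/3, Δj + ΔL/3, Δk)` has integer last coordinate in `(−1,1)`, so `Δk = 0`, hence `ΔL = 0`
(same layer, same letter) and then `Δi = Δj = 0`.  This is the packing device behind the
plateau-height bound of part 3 (each lattice point converts a point value of the mollifier into a
cell integral of its majorant).
WHAT THIS IS NOT: no stub; rung F-C1 not moved.
-/

noncomputable section

namespace Summit.Ventures.Crystal3D.Theorems.PlateauHeight

open MeasureTheory Set Metric
open Literature.MathematicalPhysics.StatisticalMechanics (barlowPos barlowStacking haggLabel)
open Summit.Ventures.Crystal3D.LayerChain (dot3)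

/-! ### Half-open Barlow cells: one per lattice point, volume `1/√2`, pairwise disjoint -/

/-- **Barlow cells.**  There is an assignment `p ↦ Q p` of a measurable set of volume `1/√2`
(`= (√3/2)·√(2/3)`, the co-volume of the unit-bond Barlow packings) to every point of `ℝ³`, with
`Q p` inside the Euclidean ball `B̄(p, 2)`, such that the cells of two DISTINCT points of any Barlow
stacking `barlowStacking 1 √(2/3) s` are disjoint.  (`Q p = p + T([0,1)³)`, `T` the frame
`(u, v, h e₃)` of the triangular layers: different layers live in disjoint height slabs, and within a
layer the parallelograms tile the plane.) -/
theorem exists_barlowCells :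
    ∃ Q : (Fin 3 → ℝ) → Set (Fin 3 → ℝ),
      (∀ p, MeasurableSet (Q p)) ∧
      (∀ p, volume (Q p) = ENNReal.ofReal (1 / Real.sqrt 2)) ∧
      (∀ p, ∀ q ∈ Q p, Real.sqrt (dot3 (q - p) (q - p)) ≤ 2) ∧
      (∀ (s : ℤ → ℤ) (k i j k' i' j' : ℤ), (k, i, j) ≠ (k', i', j') →
        Disjoint (Q (WithLp.ofLp (barlowPos 1 (Real.sqrt (2 / 3)) s k i j)))
          (Q (WithLp.ofLp (barlowPos 1 (Real.sqrt (2 / 3)) s k' i' j')))) := by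
  have h23 : Real.sqrt 3 * Real.sqrt (2 / 3) = Real.sqrt 2 := by
    rw [← Real.sqrt_mul (by norm_num)]; norm_num
  set h : ℝ := Real.sqrt (2 / 3) with hh_def
  set r3 : ℝ := Real.sqrt 3 with hr3_def
  have hh : 0 < h := Real.sqrt_pos.2 (by norm_num)
  have hh2 : h ^ 2 = 2 / 3 := Real.sq_sqrt (by norm_num)
  have h3 : 0 < r3 := Real.sqrt_pos.2 (by norm_num)
  have h33 : r3 ^ 2 = 3 := Real.sq_sqrt (by norm_num)
  have hr2 : 0 < Real.sqrt 2 := Real.sqrt_pos.2 (by norm_num)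
  -- the coordinate map `A d = (d₀ − d₁/√3, (2/√3) d₁, d₂/h)` and the unit box
  set M : Matrix (Fin 3) (Fin 3) ℝ := !![1, -(1 / r3), 0; 0, 2 / r3, 0; 0, 0, 1 / h] with hM
  set A : (Fin 3 → ℝ) →ₗ[ℝ] (Fin 3 → ℝ) := Matrix.toLin' M with hA
  have hA0 : ∀ d : Fin 3 → ℝ, A d 0 = d 0 - d 1 / r3 := by
    intro d
    rw [hA, Matrix.toLin'_apply, hM]
    simp [Matrix.mulVec, dotProduct, Fin.sum_univ_three]
    ring
  have hA1 : ∀ d : Fin 3 → ℝ, A d 1 = 2 / r3 * d 1 := by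
    intro d
    rw [hA, Matrix.toLin'_apply, hM]
    simp [Matrix.mulVec, dotProduct, Fin.sum_univ_three]
  have hA2 : ∀ d : Fin 3 → ℝ, A d 2 = d 2 / h := by
    intro d
    rw [hA, Matrix.toLin'_apply, hM]
    simp [Matrix.mulVec, dotProduct, Fin.sum_univ_three]
    ring
  have hdet : LinearMap.det A = 2 / (r3 * h) := by
    rw [hA, LinearMap.det_toLin', hM, Matrix.det_fin_three]
    simp
    field_simp
  have hdet_ne : LinearMap.det A ≠ 0 := by rw [hdet]; positivity
  set box : Set (Fin 3 → ℝ) := Set.pi Set.univ (fun _ => Ico (0 : ℝ) 1) with hbox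
  have hbox_meas : MeasurableSet box := MeasurableSet.univ_pi fun _ => measurableSet_Ico
  have hbox_vol : volume box = 1 := by
    rw [hbox, volume_pi_pi]
    simp [Real.volume_Ico]
  have hAm : Measurable A := A.continuous_of_finiteDimensional.measurable
  refine ⟨fun p => (fun q => q - p) ⁻¹' (A ⁻¹' box), fun p => ?_, fun p => ?_, fun p q hq => ?_,
    fun s k i j k' i' j' hne => ?_⟩
  · -- measurability
    exact (hbox_meas.preimage hAm).preimage (measurable_id.sub_const p)
  · -- volume `= |det A|⁻¹ · |box| = (√3/2)·√(2/3) = 1/√2`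
    change volume ((fun q : Fin 3 → ℝ => q - p) ⁻¹' (A ⁻¹' box)) = _
    have e : (fun q : Fin 3 → ℝ => q - p) ⁻¹' (A ⁻¹' box) =
        (fun q : Fin 3 → ℝ => q + -p) ⁻¹' (A ⁻¹' box) := by
      simp [sub_eq_add_neg]
    rw [e, measure_preimage_add_right, Measure.addHaar_preimage_linearMap _ hdet_ne, hbox_vol,
      mul_one, hdet]
    congr 1
    rw [inv_div, abs_of_pos (by positivity), h23, div_eq_div_iff two_ne_zero hr2.ne']
    have : Real.sqrt 2 * Real.sqrt 2 = 2 := Real.mul_self_sqrt (by norm_num)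
    linarith
  · -- diameter: the cell lies in the Euclidean ball of radius 2 about `p`
    change q - p ∈ A ⁻¹' box at hq
    simp only [Set.mem_preimage, hbox, Set.mem_univ_pi, mem_Ico] at hq
    have h0 := hq 0
    have h1 := hq 1
    have h2 := hq 2
    rw [hA0] at h0
    rw [hA1] at h1
    rw [hA2] at h2
    set d : Fin 3 → ℝ := q - p with hd
    have hd1 : 0 ≤ d 1 ∧ d 1 < r3 / 2 := by
      constructor
      · by_contra hneg
        rw [not_le] at hneg
        have : 2 / r3 * d 1 < 0 := mul_neg_of_pos_of_neg (by positivity) hneg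
        linarith [h1.1]
      · have := h1.2
        rw [div_mul_eq_mul_div, div_lt_one h3] at this
        linarith
    have hd0 : 0 ≤ d 0 ∧ d 0 < 3 / 2 := by
      have ht : 0 ≤ d 1 / r3 ∧ d 1 / r3 < 1 / 2 := by
        constructor
        · exact div_nonneg hd1.1 h3.le
        · rw [div_lt_iff₀ h3]; linarith [hd1.2]
      constructor <;> linarith [h0.1, h0.2, ht.1, ht.2]
    have hd2 : 0 ≤ d 2 ∧ d 2 < h := by
      constructor
      · by_contra hneg
        rw [not_le] at hneg
        have : d 2 / h < 0 := div_neg_of_neg_of_pos hneg hh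
        linarith [h2.1]
      · have := h2.2
        rwa [div_lt_one hh] at this
    have hsq : dot3 d d ≤ 4 := by
      simp only [dot3]
      have e2 : d 2 * d 2 < 2 / 3 := by nlinarith [hd2.1, hd2.2, hh2]
      nlinarith [hd0.1, hd0.2, hd1.1, hd1.2, h33]
    calc Real.sqrt (dot3 d d) ≤ Real.sqrt 4 := Real.sqrt_le_sqrt hsq
      _ = 2 := by rw [show (4 : ℝ) = 2 ^ 2 by norm_num, Real.sqrt_sq (by norm_num)]
  · -- disjointness of the cells of distinct lattice points
    rw [Set.disjoint_left]
    intro q hq hq'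
    apply hne
    change q - WithLp.ofLp (barlowPos 1 h s k i j) ∈ A ⁻¹' box at hq
    change q - WithLp.ofLp (barlowPos 1 h s k' i' j') ∈ A ⁻¹' box at hq'
    simp only [Set.mem_preimage, hbox, Set.mem_univ_pi, mem_Ico] at hq hq'
    set P := WithLp.ofLp (barlowPos 1 h s k i j) with hP
    set P' := WithLp.ofLp (barlowPos 1 h s k' i' j') with hP'
    -- coordinates of `A (P' − P)`: `(Δi + ΔL/3, Δj + ΔL/3, Δk)`, each in `(−1, 1)`
    have hdiff : ∀ l : Fin 3, -1 < A (P' - P) l ∧ A (P' - P) l < 1 := by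
      intro l
      have e : A (P' - P) = A (q - P) - A (q - P') := by
        rw [← map_sub]; congr 1; abel
      rw [e, Pi.sub_apply]
      constructor <;> linarith [(hq l).1, (hq l).2, (hq' l).1, (hq' l).2]
    have hP0 : P 0 = (i : ℝ) + j / 2 + haggLabel s k / 2 := by rw [hP]; simp
    have hP1 : P 1 = r3 / 2 * (j + haggLabel s k / 3) := by rw [hP]; simp [hr3_def]
    have hP2 : P 2 = k * h := by rw [hP]; simp
    have hP0' : P' 0 = (i' : ℝ) + j' / 2 + haggLabel s k' / 2 := by rw [hP']; simp
    have hP1' : P' 1 = r3 / 2 * (j' + haggLabel s k' / 3) := by rw [hP']; simp [hr3_def]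
    have hP2' : P' 2 = k' * h := by rw [hP']; simp
    have c2 : A (P' - P) 2 = (k' : ℝ) - k := by
      rw [hA2, Pi.sub_apply, hP2, hP2', div_eq_iff hh.ne']
      ring
    have c1 : A (P' - P) 1 = ((j' : ℝ) - j) + (haggLabel s k' - haggLabel s k : ℝ) / 3 := by
      rw [hA1, Pi.sub_apply, hP1, hP1']
      field_simp
      ring
    have c0 : A (P' - P) 0 = ((i' : ℝ) - i) + (haggLabel s k' - haggLabel s k : ℝ) / 3 := by
      rw [hA0, Pi.sub_apply, Pi.sub_apply, hP0, hP0', hP1, hP1']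
      field_simp
      ring
    -- `Δk = 0`
    have hk : k = k' := by
      have hl := hdiff 2
      rw [c2] at hl
      have e1 : ((k' - k : ℤ) : ℝ) < 1 := by push_cast; exact hl.2
      have e2 : (-1 : ℝ) < ((k' - k : ℤ) : ℝ) := by push_cast; exact hl.1
      have : k' - k < 1 := by exact_mod_cast e1
      have : -1 < k' - k := by exact_mod_cast e2
      omega
    subst hk
    have hi : i = i' := by
      have hl := hdiff 0
      rw [c0] at hl
      simp only [sub_self, zero_div, add_zero] at hl
      have e1 : ((i' - i : ℤ) : ℝ) < 1 := by push_cast; exact hl.2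
      have e2 : (-1 : ℝ) < ((i' - i : ℤ) : ℝ) := by push_cast; exact hl.1
      have : i' - i < 1 := by exact_mod_cast e1
      have : -1 < i' - i := by exact_mod_cast e2
      omega
    have hj : j = j' := by
      have hl := hdiff 1
      rw [c1] at hl
      simp only [sub_self, zero_div, add_zero] at hl
      have e1 : ((j' - j : ℤ) : ℝ) < 1 := by push_cast; exact hl.2
      have e2 : (-1 : ℝ) < ((j' - j : ℤ) : ℝ) := by push_cast; exact hl.1
      have : j' - j < 1 := by exact_mod_cast e1
      have : -1 < j' - j := by exact_mod_cast e2
      omega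
    rw [hi, hj]


end Summit.Ventures.Crystal3D.Theorems.PlateauHeight

end
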